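import Literature.IUT.HodgeTheaters.TemperedCoveringsFreeModelProp24Tower
import Literature.IUT.HodgeTheaters.TemperedCoveringsFreeModelLevelData
import Literature.IUT.HodgeTheaters.TemperedCoveringsFreeModelLevelCommTerminal
import HarnessLib

/-!
# Joint satisfiability of the [IUTchI] Prop. 2.4 tower laws AND the Cor. 2.3-at-levels laws at one datum

Mochizuki, *Inter-universal Teichmüller theory I*, kurims manuscript (May 2020), §2, Proposition 2.4 (i)
p. 50 (the tower of "finite index characteristic open subgroups `J ⊆ Δ^tp_X`") and Corollary 2.3 (i), (vi)
pp. 47–48 read at the levels `J` ([IUTchI] Prop 2.4(i) p.50) [claim: Mochizuki2012, status: disputed]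
(D-0012 claim key; nothing of the series is asserted here).

PROOF-ONLY CAPSTONE (abc-iut cell, NV-L5 rows `Prop24Tower` (abc-iut-w4-d012, p421770) and
`Prop24Tower.SubgraphLevelData` (abc-iut-w4-d063, p422307 + p423759)): at abc-iut-L5-d4's toy datum
`StableCurveTemperedData.FreeModel.toy` (`F₂ ↪ F̂₂`, bouquet `B₂`, `ℍ` = the `x₀`-loop) there is ONE tower — the
GENUINE multi-level tower of all finite-index normal subgroups of `F₂` — carrying Schreier-coset level subgraph
data such that ALL TEN named tower laws of abc-iut-w5-d119's sub-DAG of Prop. 2.4 (i) AND ALL named laws of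
abc-iut-L5-t11's `SubgraphLevelData` (B1 `LevelActsTrivially`/`DeltaHStabilizes`/`StabLeDeltaHLevel`,
B2 `LevelCommTerminal`, B3 `LevelIncidence`, B4 `CompsDisjoint`/`CompsInvariant`/`IsBlock`, and the per-level
target `LevelTarget`) hold SIMULTANEOUSLY — so no theorem quantified over this binder package is vacuous.
HONEST SCOPE, as in the parents: the `Λ`-quantified tower clauses and the cusp-indexed level clauses hold
vacuously at the toy (no nontrivial compact subgroups, no cusps); nothing here is the arithmetic situation of
p. 50; a `_model` over the L3 producers stays BLOCKED-UPSTREAM.  No definition; nothing here bears on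
[IUTchIII] Cor. 3.12; instantiated ≠ endorsed.
-/

namespace Literature.IUT.HodgeTheaters

namespace StableCurveTemperedData

namespace FreeModel

/-- **Joint satisfiability at the toy: the Prop. 2.4 (i) tower laws together with the Cor. 2.3-at-levels
laws.**  abc-iut-w4-d012's tower of all finite-index normal subgroups of `F₂` (`exists_prop24Tower_model`)
carries the Schreier-coset level subgraph data of `SubgraphLevelData.exists_model_free`, and — its levels being
normal and open — satisfies `LevelCommTerminal` (`levelCommTerminal_free_of_levelsOpen`).
([IUTchI] Prop 2.4(i) p.50) [claim: Mochizuki2012, status: disputed] -/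
theorem exists_prop24Tower_subgraphLevelData_model :
    ∃ (T : toy.Prop24Tower) (L : T.SubgraphLevelData),
      (T.LevelsClosed ∧ T.LevelsInDelta ∧ T.LevelsNormal ∧ T.LevelsOpen ∧ T.LevelsCofinal ∧
        T.Translate ∧ T.DetectsTempered ∧ T.SpecializationAb ∧ T.LevelsDetect ∧ T.Prop21Levels) ∧
      (∀ i, L.Vtx i = (F2 ⧸ (T.Jhat i).comap toy.ιX)) ∧
      L.CompsDisjoint ∧ L.CompsInvariant ∧ L.IsBlock ∧ L.LevelActsTrivially ∧ L.DeltaHStabilizes ∧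
      L.StabLeDeltaHLevel ∧ L.LevelIncidence ∧ T.LevelTarget ∧
      Prop24Tower.SubgraphLevelData.LevelCommTerminal (T := T) := by
  obtain ⟨T, hC, hΔ, hN, hO, hcof, htr, hdet, hab, hLD, h21⟩ := exists_prop24Tower_model
  obtain ⟨L, hV, hdisj, hinv, hblk, htriv, hH, hstab, hinc, htgt⟩ :=
    SubgraphLevelData.exists_model_free T hN
  exact ⟨T, L, ⟨hC, hΔ, hN, hO, hcof, htr, hdet, hab, hLD, h21⟩, hV, hdisj, hinv, hblk, htriv, hH, hstab,
    hinc, htgt, levelCommTerminal_free_of_levelsOpen T hO⟩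

/-- **All three [IUTchI] Prop. 2.4 hypothesis structures at once, at the toy**: abc-iut-w4-d012's tower with
its ten (i)-laws, the Schreier-coset level subgraph data with all its named laws, and the level-constant
quotient tower of (ii) with `LevelObservation` ∧ `QDetectsTempered` (`Prop24QTower.exists_model_free`) —
one datum instantiating every binder package of abc-iut-w5-d119's / abc-iut-L5-t11's sub-DAG files (the
`Λ`- and cusp-quantified clauses vacuously, as the parents say). ([IUTchI] Prop 2.4 pp.50-51) [claim: Mochizuki2012, status: disputed] -/
theorem exists_prop24_structures_model :
    (∃ (T : toy.Prop24Tower) (L : T.SubgraphLevelData),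
      (T.LevelsClosed ∧ T.LevelsInDelta ∧ T.LevelsNormal ∧ T.LevelsOpen ∧ T.LevelsCofinal ∧
        T.Translate ∧ T.DetectsTempered ∧ T.SpecializationAb ∧ T.LevelsDetect ∧ T.Prop21Levels) ∧
      (∀ i, L.Vtx i = (F2 ⧸ (T.Jhat i).comap toy.ιX)) ∧
      L.CompsDisjoint ∧ L.CompsInvariant ∧ L.IsBlock ∧ L.LevelActsTrivially ∧ L.DeltaHStabilizes ∧
      L.StabLeDeltaHLevel ∧ L.LevelIncidence ∧ T.LevelTarget ∧
      Prop24Tower.SubgraphLevelData.LevelCommTerminal (T := T)) ∧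
    (∃ Tq : toy.Prop24QTower, (∀ j, Tq.Q j = toy.graph) ∧ Tq.LevelObservation ∧ Tq.QDetectsTempered) ∧
    toy.Prop24i ∧ toy.Prop24ii :=
  ⟨exists_prop24Tower_subgraphLevelData_model, Prop24QTower.exists_model_free, prop24i_model, prop24ii⟩

end FreeModel

end StableCurveTemperedData

end Literature.IUT.HodgeTheaters
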